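import Summits.QuantumFields.BalabanUV.T4Continuum.Support.NE7EnergyRateWGeneric
import Summits.QuantumFields.BalabanUV.T4Continuum.Support.NE7EnergyBlockLandauClassPoincareSU3
import HarnessLib

/-!
# NE7EnergyRateWSU3 — NODE NE3's RE-TYPED ROOT T-E_w♯ FOR SU(3)∕U(3), d = 4, L = 2, NO DISPLAYED HYPOTHESIS: `NE7EnergyRateWGeneric.ne3EnergyRateWSup_of_classPoincare` with the SU(3) class
# slice-Poincaré inequality of `𝒯_E` (`NE7EnergyBlockLandauClassPoincareSU3.classSlicePoincare_energyBlockLandau_SU3`, constant `12·CPLine 4 2 3 10⁻¹⁷ 10⁻⁵³`, radius `10⁻⁵³`)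

Cell `pub-balaban`, rung (B)+1 sub-cell t4, lineage `b2b-balaban-t4-ne7-p1`, generation 105 (CRUX PROVER NE7 #1 = OWNER of BINDER row NE7).  Memo `t4/b2b-balaban-t4-ne7-p1-g105/ROAD-G105.md` §8.
WHAT ([folklore]; 0 def, 0 sorry).  **`ne3EnergyRateWSup_SU3`**: `card n = 3 → ∃ ε₀ > 0, ∀ 0 < ε ≤ ε₀, ∀ b g, 0 ≤ b → b + 10⁸b² ≤ ε → 0 < g → ∃ C s ≥ 0, ∀ N ≥ 1, ∀ dom,
NE3EnergyRateWSup 4 (sfClass 4 2 N ε) 2 N b g C s dom` — for every level and every minimiser pair of the U(3) small-field class, the η-rate of the block-averaged finer minimiser against the coarser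
one in the weighted energy norm, plus the sup letter.  (Non-vacuity of the minimiser pairs with `Regular` data at SU(3) is NOT in the tree: the (8)∃∕(H∃)ᴱ chain of gens 93–104 is SU(2)-only.)
HONEST FRAMING (page 1): composition; nothing of Bałaban's asserted as an axiom; `n : Type`; constants existential; NOT NE3∕NE7 as spine nodes; NOT infinite volume, NOT mass gap, NOT BetaPertH, NOT Clay
(continuum YM on T⁴ ⇐ BetaPertH ∧ nine spine estimates).
-/

set_option autoImplicit false

open scoped BigOperators Matrix Matrix.Norms.L2Operator
open NormedSpace Finset Set

namespace Summit.QuantumFields.BalabanUV.T4Continuum.NE7EnergyRateWSU3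

open Literature.MathematicalPhysics.QuantumFieldTheory.Balaban1983to89
open B7Prop1Explicit B7Prop2Explicit
open MinimalActionRate (sfClass)
open NE3SlicePoincareBudgetLine (CPLine)
open NE3ClassRadiusFamily (CPLine_nonneg)
open NE3EnergyWeightedSupShape (NE3EnergyRateWSup)
open NE7EnergyRateWGeneric (ne3EnergyRateWSup_of_classPoincare)
open NE7EnergyBlockLandauClassPoincareSU3 (classSlicePoincare_energyBlockLandau_SU3)

noncomputable section

variable {n : Type} [Fintype n] [DecidableEq n]

/-- **T-E_w♯ FOR SU(3)∕U(3), `d = 4`, `L = 2`, NO DISPLAYED HYPOTHESIS** (statement in the file header). [folklore] -/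
theorem ne3EnergyRateWSup_SU3 [Nonempty n] (hn : Fintype.card n = 3) :
    ∃ ε₀ : ℝ, 0 < ε₀ ∧ ∀ ε : ℝ, 0 < ε → ε ≤ ε₀ → ∀ b g : ℝ, 0 ≤ b → b + 10 ^ 8 * b ^ 2 ≤ ε → 0 < g →
      ∃ C s : ℝ, 0 ≤ C ∧ 0 ≤ s ∧ ∀ (N : ℕ) [NeZero N] (dom : Set (Site 4 → Fin 4 → (Matrix n n ℂ)ˣ)),
        NE3EnergyRateWSup 4 (sfClass 4 2 N ε) 2 N b g C s dom := by
  have hC0 : 0 ≤ 12 * CPLine 4 2 3 (1 / 10 ^ 17) (1 / 10 ^ 53) := by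
    have := CPLine_nonneg (d := 4) (L := 2) (by norm_num) (show (0 : ℝ) ≤ 3 by norm_num) (show (0 : ℝ) ≤ 1 / 10 ^ 17 by norm_num)
      (show (0 : ℝ) ≤ 1 / 10 ^ 53 by norm_num)
    positivity
  exact ne3EnergyRateWSup_of_classPoincare (n := n) hC0 (by norm_num : (0 : ℝ) < 1 / 10 ^ 53) (by norm_num)
    (fun N _ hN ε hε hε1 j W hW => classSlicePoincare_energyBlockLandau_SU3 hn hN hε hε1 j W hW)

end

end Summit.QuantumFields.BalabanUV.T4Continuum.NE7EnergyRateWSU3
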